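import Summits.HubbardSuperconductivity.HubbardSuperconductivity.Theorems.AnisotropyChordTransferFibre3RowCCellSound
import Summits.HubbardSuperconductivity.HubbardSuperconductivity.Theorems.AnisotropyChordTransferFibre3RowCWindow3
import Summits.HubbardSuperconductivity.HubbardSuperconductivity.Theorems.AnisotropyChordTransferFibre3ShellBulk
import Summits.HubbardSuperconductivity.HubbardSuperconductivity.Theorems.AnisotropyChordTransferFibre3ManifoldBand
import Summits.HubbardSuperconductivity.HubbardSuperconductivity.Theorems.AnisotropyChordTransferFibre3B1Instances

/-!
# Row C (KT-2b) — the window-shell majorant, I: algebra and the window numbers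

Sub-problem `HubbardSuperconductivity`, route `AnisotropyChord`, helper toward `FerroSideChordLarge` (stmt-23918), row C of the
GM₃ `∀L` certificate. The composition `RowC.offPoleTail_of_rowCCheck` (`…RowCCellSound`) takes the hypothesis
`Σ_{b ∈ shellWin} C0(x̂,b)² ≤ ZwN` (`ZwN = 6·Cw²`, `…RowCExpr`). This file supplies the two ingredients of its proof
(`…RowCShellWin`): (i) the pure algebra `c0_abs_le` — from the regrouped shell form
`C0 = ½(f_nn P₁² − f_nn Σ PᵢQᵢ + ξ(F_c P₂ + F_b Q₁) + ζ(F_c(P₃+P₄) + F_b(Q₃+Q₄)))` (`ShellRow.c0_shell_PQRT`) and slot bounds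
`|P₁|,|Q₂| ≤ g`, `|Pᵢ| ≤ Bᵢ`, `|Qᵢ| ≤ Cᵢ` with `ΣBC`-budgets, `|C0| ≤ ½f g² + ½f(3g² + gF) + ½W(ξ⁺(g+F) + ζ⁺(3g+F)) = Cw`;
(ii) the window numbers of the ground profile for `L ≥ 128`, `0 ≤ Δ < 1`: `f(r) = a + c_s a_λ(r)` (`r ≠ 0`), `c_s ≥ 0`, `a ≥ 0`,
`0.115 c_s ≤ f(x̂)`, and the five enclosures `a_λ(1,0) ∈ [0.24998, 0.25]`, `a_λ(1,1) ∈ [0.3173, 0.31931]`,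
`a_λ(2,0) ∈ [0.3623, 0.3644]`, `a_λ(2,1) ∈ [0.385618, 0.38762]`, `a_λ(3,0) ∈ [0.42728, 0.4333]`
(`ManifoldA.axis_window_closed`, `RowC.window_k11_k20`, `RowC.third_shell_window`), plus the lattice-symmetry transport of
`f` on integer sites (`B1.toTor`). [folklore]
-/

set_option linter.dupNamespace false
set_option autoImplicit false

open Finset

open scoped BigOperators

namespace Summit.HubbardSuperconductivity.HubbardSuperconductivity.Theorems.AnisotropyChord.Transfer.Fibre3

namespace RowC

variable (L : ℕ) [NeZero L]

/-! ## §1 Pure algebra -/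

omit [NeZero L] in
/-- ★ THE SLOT ALGEBRA: from the regrouped shell form and termwise slot bounds,
`|C| ≤ ½f_nn g² + ½f_nn(3g² + gF) + ½W(ξ⁺(g + F) + ζ⁺(3g + F))`. [folklore] -/
theorem c0_abs_le {fnn ξ ζ Fb Fc P1 P2 P3 P4 Q1 Q2 Q3 Q4 C g F W xi ze B2 B3 B4 C1 C3 C4 : ℝ}
    (hC : C = (1 / 2 : ℝ) * (fnn * P1 ^ 2 - fnn * (P1 * Q1 + P2 * Q2 + P3 * Q3 + P4 * Q4)
      + ξ * (Fc * P2 + Fb * Q1) + ζ * (Fc * (P3 + P4) + Fb * (Q3 + Q4))))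
    (hfnn : 0 ≤ fnn) (hW : 0 ≤ W) (hxi : |ξ| ≤ xi) (hze : |ζ| ≤ ze)
    (hFb : |Fb| ≤ W) (hFc : |Fc| ≤ W)
    (p1 : |P1| ≤ g) (p2 : |P2| ≤ B2) (p3 : |P3| ≤ B3) (p4 : |P4| ≤ B4)
    (q1 : |Q1| ≤ C1) (q2 : |Q2| ≤ g) (q3 : |Q3| ≤ C3) (q4 : |Q4| ≤ C4)
    (h1 : g * C1 + B2 * g + B3 * C3 + B4 * C4 ≤ 3 * g ^ 2 + g * F)
    (h2 : B2 + C1 ≤ g + F) (h3 : B3 + B4 + C3 + C4 ≤ 3 * g + F) :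
    |C| ≤ fnn / 2 * g ^ 2 + fnn / 2 * (3 * g ^ 2 + g * F) + W / 2 * (xi * (g + F) + ze * (3 * g + F)) := by
  -- `|x·y| ≤ a·b` (cf. `Literature…abs_mul_le_of_le`) and the four-term triangle inequality (cf. `Literature…abs_add_four_le`), inlined
  have amul : ∀ {x y a b : ℝ}, |x| ≤ a → |y| ≤ b → |x * y| ≤ a * b := fun hx hy => by
    rw [abs_mul]
    exact mul_le_mul hx hy (abs_nonneg _) ((abs_nonneg _).trans hx)
  have abs_add_four : ∀ x₁ x₂ x₃ x₄ : ℝ, |x₁ + x₂ + x₃ + x₄| ≤ |x₁| + |x₂| + |x₃| + |x₄| := fun _ _ _ _ =>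
    (abs_add_le _ _).trans (add_le_add ((abs_add_le _ _).trans (add_le_add (abs_add_le _ _) le_rfl)) le_rfl)
  have hxi0 : 0 ≤ xi := (abs_nonneg _).trans hxi
  have hze0 : 0 ≤ ze := (abs_nonneg _).trans hze
  have hu : |fnn * P1 ^ 2| ≤ fnn * g ^ 2 := by
    rw [abs_mul, abs_of_nonneg hfnn, abs_of_nonneg (sq_nonneg _)]
    exact mul_le_mul_of_nonneg_left (ShellRow.sq_le_sq_of_abs_le p1) hfnn
  have hv : |fnn * (P1 * Q1 + P2 * Q2 + P3 * Q3 + P4 * Q4)| ≤ fnn * (3 * g ^ 2 + g * F) := by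
    rw [abs_mul, abs_of_nonneg hfnn]
    refine mul_le_mul_of_nonneg_left ?_ hfnn
    have e1 := amul p1 q1
    have e2 := amul p2 q2
    have e3 := amul p3 q3
    have e4 := amul p4 q4
    linarith [abs_add_four (P1 * Q1) (P2 * Q2) (P3 * Q3) (P4 * Q4)]
  have hw : |ξ * (Fc * P2 + Fb * Q1)| ≤ xi * (W * (g + F)) := by
    rw [abs_mul]
    refine mul_le_mul hxi ?_ (abs_nonneg _) hxi0
    have e1 := amul hFc p2
    have e2 := amul hFb q1
    calc |Fc * P2 + Fb * Q1| ≤ |Fc * P2| + |Fb * Q1| := abs_add_le _ _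
      _ ≤ W * (B2 + C1) := by linarith
      _ ≤ W * (g + F) := mul_le_mul_of_nonneg_left h2 hW
  have hz : |ζ * (Fc * (P3 + P4) + Fb * (Q3 + Q4))| ≤ ze * (W * (3 * g + F)) := by
    rw [abs_mul]
    refine mul_le_mul hze ?_ (abs_nonneg _) hze0
    have e1 := amul hFc ((abs_add_le P3 P4).trans (add_le_add p3 p4))
    have e2 := amul hFb ((abs_add_le Q3 Q4).trans (add_le_add q3 q4))
    calc |Fc * (P3 + P4) + Fb * (Q3 + Q4)| ≤ |Fc * (P3 + P4)| + |Fb * (Q3 + Q4)| := abs_add_le _ _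
      _ ≤ W * (B3 + B4 + C3 + C4) := by linarith
      _ ≤ W * (3 * g + F) := mul_le_mul_of_nonneg_left h3 hW
  have htot := abs_add_four (fnn * P1 ^ 2) (-(fnn * (P1 * Q1 + P2 * Q2 + P3 * Q3 + P4 * Q4)))
    (ξ * (Fc * P2 + Fb * Q1)) (ζ * (Fc * (P3 + P4) + Fb * (Q3 + Q4)))
  rw [abs_neg, ← sub_eq_add_neg] at htot
  rw [hC, abs_mul, abs_of_pos (by norm_num : (0 : ℝ) < 1 / 2)]
  linarith

/-! ## §2 Integer sites and the symmetries of the ground profile -/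

omit [NeZero L] in
/-- `toTor (p − q) = toTor p − toTor q`. [folklore] -/
theorem toTor_sub (p q : ℤ × ℤ) : B1.toTor L (p - q) = B1.toTor L p - B1.toTor L q := by
  unfold B1.toTor
  ext <;> simp

omit [NeZero L] in
/-- `x̂ = toTor(1,0)`, `ŷ = toTor(0,1)`, `K₁ = toTor(1,0)`. [folklore] -/
theorem ex_ey_toTor : B1.toTor L ((1 : ℤ), (0 : ℤ)) = ex L ∧ B1.toTor L ((0 : ℤ), (1 : ℤ)) = ey L ∧
    B1.toTor L ((1 : ℤ), (0 : ℤ)) = K1 L := by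
  unfold B1.toTor ex ey K1
  refine ⟨?_, ?_, ?_⟩ <;> ext <;> simp

/-- an integer site with a coordinate in `(0, L)` in absolute value is nonzero on the torus. [folklore] -/
theorem toTor_ne_zero_fst {x y : ℤ} (hx : x ≠ 0) (hxL : |x| < L) : B1.toTor L (x, y) ≠ 0 := by
  intro h
  have h1 : ((x : ℤ) : ZMod L) = 0 := by
    have := congrArg Prod.fst h
    simpa [B1.toTor] using this
  rw [ZMod.intCast_zmod_eq_zero_iff_dvd] at h1
  have hL0 : (0 : ℤ) < L := by
    have := NeZero.ne L
    omega
  have := Int.le_of_dvd (abs_pos.mpr hx) ((dvd_abs _ _).mpr h1)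
  omega

/-- see `toTor_ne_zero_fst`. [folklore] -/
theorem toTor_ne_zero_snd {x y : ℤ} (hy : y ≠ 0) (hyL : |y| < L) : B1.toTor L (x, y) ≠ 0 := by
  intro h
  have h1 : ((y : ℤ) : ZMod L) = 0 := by
    have := congrArg Prod.snd h
    simpa [B1.toTor] using this
  rw [ZMod.intCast_zmod_eq_zero_iff_dvd] at h1
  have hL0 : (0 : ℤ) < L := by
    have := NeZero.ne L
    omega
  have := Int.le_of_dvd (abs_pos.mpr hy) ((dvd_abs _ _).mpr h1)
  omega

omit [NeZero L] in
/-- transport of an x-mirror / even / swap-symmetric profile on integer sites. [folklore] -/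
theorem f_toTor_symm {f : Tor L → ℝ} (heven : ∀ r : Tor L, f (-r) = f r)
    (hmi : ∀ r : Tor L, f (-r.1, r.2) = f r) (hsw : ∀ r : Tor L, f (r.2, r.1) = f r) (x y : ℤ) :
    f (B1.toTor L (-x, y)) = f (B1.toTor L (x, y)) ∧ f (B1.toTor L (x, -y)) = f (B1.toTor L (x, y)) ∧
    f (B1.toTor L (y, x)) = f (B1.toTor L (x, y)) := by
  have e1 : B1.toTor L (-x, y) = (-(B1.toTor L (x, y)).1, (B1.toTor L (x, y)).2) := by
    unfold B1.toTor; ext <;> simp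
  have e2 : B1.toTor L (x, -y) = -((-(B1.toTor L (x, y)).1, (B1.toTor L (x, y)).2) : Tor L) := by
    unfold B1.toTor; ext <;> simp
  have e3 : B1.toTor L (y, x) = ((B1.toTor L (x, y)).2, (B1.toTor L (x, y)).1) := by
    unfold B1.toTor; ext <;> simp
  refine ⟨by rw [e1, hmi], by rw [e2, heven, hmi], by rw [e3, hsw]⟩

/-! ## §3 The window numbers of the ground profile -/

/-- `1/π ∈ (0.318309, 0.3183099)` re-exported in the shape used below. [folklore] -/
theorem window_k21_k30 (hL : 128 ≤ L) {Δ lam2 : ℝ} {f : Tor L → ℝ} (hΔ0 : 0 ≤ Δ) (hΔ1 : Δ < 1)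
    (hf : IsGroundTwoMagnon L Δ lam2 f) :
    (0.385618 ≤ aKer L lam2 (B1.toTor L ((2 : ℤ), (1 : ℤ))) ∧ aKer L lam2 (B1.toTor L ((2 : ℤ), (1 : ℤ))) ≤ 0.38762) ∧
    (0.42728 ≤ aKer L lam2 (B1.toTor L ((3 : ℤ), (0 : ℤ))) ∧ aKer L lam2 (B1.toTor L ((3 : ℤ), (0 : ℤ))) ≤ 0.4333) := by
  have hLpos : (0 : ℝ) < L := by exact_mod_cast (show 0 < L by omega)
  have hπ := Real.pi_pos
  set θ : ℝ := 2 * Real.pi / L with hθ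
  have ht0 : 0 < θ ^ 2 := by positivity
  have hlam : 0 < lam2 := lam2_pos L (by omega) hΔ1 hf.1
  have hνc := ManifoldA.nu_ceiling L hL hΔ0 hf
  have hν0 : 0 ≤ lam2 / θ ^ 2 := by positivity
  have hν5 : lam2 / θ ^ 2 ≤ 0.0513 := by
    rw [div_le_iff₀ ht0, hθ]
    have hx0 : 0 ≤ (2 * Real.pi / (L : ℝ)) ^ 2 := sq_nonneg _
    linarith [hνc]
  have hlamθ : lam2 = lam2 / θ ^ 2 * (2 * Real.pi / L) ^ 2 := by rw [hθ]; field_simp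
  obtain ⟨hw21, hw30⟩ := third_shell_window L hL (lam2 / θ ^ 2) hν0 hν5
  rw [← hlamθ] at hw21 hw30
  have e21 : ((((2 : ℤ)) : ZMod L), (((1 : ℤ)) : ZMod L)) = B1.toTor L ((2 : ℤ), (1 : ℤ)) := rfl
  have e30 : ((((3 : ℤ)) : ZMod L), (((0 : ℤ)) : ZMod L)) = B1.toTor L ((3 : ℤ), (0 : ℤ)) := rfl
  rw [e21] at hw21
  rw [e30] at hw30
  obtain ⟨hp1, hp2⟩ := inv_pi_bounds
  obtain ⟨hl1, hh1⟩ := abs_le.mp hw21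
  obtain ⟨hl2, hh2⟩ := abs_le.mp hw30
  have e2 : 2 / Real.pi = 2 * (1 / Real.pi) := by ring
  have e12 : 12 / Real.pi = 12 * (1 / Real.pi) := by ring
  rw [e2] at hl1 hh1
  rw [e12] at hl2 hh2
  exact ⟨⟨by linarith, by linarith⟩, ⟨by linarith, by linarith⟩⟩

/-- the second-shell values on integer sites: `a_λ(1,1) ∈ [0.3173, 0.31931]`, `a_λ(2,0) ∈ [0.3623, 0.3644]`. [folklore] -/
theorem window_k11_k20' (hL : 128 ≤ L) {Δ lam2 : ℝ} {f : Tor L → ℝ} (hΔ0 : 0 ≤ Δ) (hΔ1 : Δ < 1)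
    (hf : IsGroundTwoMagnon L Δ lam2 f) :
    (0.3173 ≤ aKer L lam2 (B1.toTor L ((1 : ℤ), (1 : ℤ))) ∧ aKer L lam2 (B1.toTor L ((1 : ℤ), (1 : ℤ))) ≤ 0.31931) ∧
    (0.3623 ≤ aKer L lam2 (B1.toTor L ((2 : ℤ), (0 : ℤ))) ∧ aKer L lam2 (B1.toTor L ((2 : ℤ), (0 : ℤ))) ≤ 0.3644) := by
  obtain ⟨⟨h1, h2⟩, ⟨h3, h4⟩⟩ := window_k11_k20 L hL hΔ0 hΔ1 hf
  have e11 : B1.toTor L ((1 : ℤ), (1 : ℤ)) = ex L + ey L := by unfold B1.toTor ex ey; ext <;> simp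
  have e20 : B1.toTor L ((2 : ℤ), (0 : ℤ)) = ex L + ex L := by
    unfold B1.toTor ex; ext <;> simp
    norm_num
  rw [e11, e20]
  simp only [k11I, k20I] at h1 h2 h3 h4
  push_cast at h1 h2 h3 h4
  exact ⟨⟨by linarith, by linarith⟩, ⟨by linarith, by linarith⟩⟩

/-- the axis value `a_λ(1,0) = (1 − 1/V + (1 − a + a/V)/(V + a))/4 ∈ [0.24998, 0.25]` (`V ≥ 16384`, `0 ≤ a`, `a(1 − 1/V) < 1`). [folklore] -/
theorem window_k10 (hL : 128 ≤ L) {Δ lam2 : ℝ} {f : Tor L → ℝ} (hΔ0 : 0 ≤ Δ) (hΔ1 : Δ < 1)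
    (hf : IsGroundTwoMagnon L Δ lam2 f) :
    0.24998 ≤ aKer L lam2 (B1.toTor L ((1 : ℤ), (0 : ℤ))) ∧ aKer L lam2 (B1.toTor L ((1 : ℤ), (0 : ℤ))) ≤ 0.25 := by
  have hL5 : 5 ≤ L := by omega
  have hLpos : (0 : ℝ) < L := by exact_mod_cast (show 0 < L by omega)
  have hL128 : (128 : ℝ) ≤ L := by exact_mod_cast hL
  obtain ⟨hax, _⟩ := ManifoldA.axis_window_closed L hL5 hΔ0 hΔ1 hf
  obtain ⟨ha0, haV, _⟩ := ManifoldA.manifold_band L hL hΔ0 hΔ1 hf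
  rw [(ex_ey_toTor L).1, hax (ex L) (ex_mem_nnList L)]
  set a : ℝ := Δ * f (K1 L) with ha
  set V : ℝ := (L : ℝ) ^ 2 with hV
  have hV0 : (16384 : ℝ) ≤ V := by rw [hV]; nlinarith
  have hVpos : 0 < V := by linarith
  have hVa : 0 < V + a := by linarith
  have hnum : 0 ≤ 1 - a + a / V := by
    have : a * (1 - 1 / V) < 1 := haV
    have e : 1 - a + a / V = 1 - a * (1 - 1 / V) := by ring
    rw [e]; linarith
  have hfrac0 : 0 ≤ (1 - a + a / V) / (V + a) := div_nonneg hnum hVa.le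
  have hfrac1 : (1 - a + a / V) / (V + a) ≤ 1 / V := by
    rw [div_le_div_iff₀ hVa hVpos]
    have e : (1 - a + a / V) * V = V - a * V + a := by field_simp
    rw [e]; nlinarith
  have hinv : 1 / V ≤ 1 / 16384 := one_div_le_one_div_of_le (by norm_num) hV0
  constructor
  · linarith
  · linarith

/-- ★ the window dictionary of the ground profile (`L ≥ 128`, `0 ≤ Δ < 1`): `c_s ≥ 0`, `a ≥ 0`, `f(r) = a + c_s a_λ(r)` off the origin,
`f(K₁) = a + c_s a_λ(1,0)` and `0.115·c_s ≤ f(K₁)`. [folklore] -/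
theorem window_dictionary (hL : 128 ≤ L) {Δ lam2 : ℝ} {f : Tor L → ℝ} (hΔ0 : 0 ≤ Δ) (hΔ1 : Δ < 1)
    (hf : IsGroundTwoMagnon L Δ lam2 f) :
    0 ≤ cS L Δ lam2 f ∧ 0 ≤ Δ * f (K1 L) ∧
    (∀ r : Tor L, r ≠ 0 → f r = Δ * f (K1 L) + cS L Δ lam2 f * aKer L lam2 r) ∧
    f (K1 L) = Δ * f (K1 L) + cS L Δ lam2 f * aKer L lam2 (B1.toTor L ((1 : ℤ), (0 : ℤ))) ∧
    0.115 * cS L Δ lam2 f ≤ f (K1 L) := by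
  have hL5 : 5 ≤ L := by omega
  have hL2 : 2 ≤ L := by omega
  have hLpos : (0 : ℝ) < L := by exact_mod_cast (show 0 < L by omega)
  have hL128 : (128 : ℝ) ≤ L := by exact_mod_cast hL
  have hπ := Real.pi_pos
  obtain ⟨_, hwin⟩ := ManifoldA.axis_window_closed L hL5 hΔ0 hΔ1 hf
  obtain ⟨ha0, _, _⟩ := ManifoldA.manifold_band L hL hΔ0 hΔ1 hf
  obtain ⟨hη, hcs, hfnn, hV⟩ := dict_N hL hΔ0 hΔ1 hf
  set t : ℝ := (2 * Real.pi / L) ^ 2 with ht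
  have ht0 : 0 < t := by positivity
  have hlam : 0 < lam2 := lam2_pos L (by omega) hΔ1 hf.1
  have hν0 : 0 < lam2 / t := div_pos hlam ht0
  have hνc : lam2 / t ≤ 0.031 := by
    rw [div_le_iff₀ ht0, ht]; exact (ManifoldA.nu_ceiling L hL hΔ0 hf).le
  have htle : t ≤ 1 := by
    rw [ht, div_pow]
    rw [div_le_one (by positivity)]
    have hπ4 : Real.pi < 4 := by linarith [Real.pi_lt_d2]
    nlinarith
  set a : ℝ := Δ * f (K1 L) with ha
  have hval : ∀ r : Tor L, r ≠ 0 → f r = a + cS L Δ lam2 f * aKer L lam2 r := by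
    intro r hr
    have := hwin r hr
    linarith
  have hcs0 : 0 ≤ cS L Δ lam2 f := by
    rw [hcs]; unfold csN etaN
    have : 0 ≤ a * t / (4 * Real.pi ^ 2) := by positivity
    have : 0 ≤ Real.pi ^ 2 * (lam2 / t) := by positivity
    positivity
  refine ⟨hcs0, ha0, hval, ?_, ?_⟩
  · rw [(ex_ey_toTor L).2.2]
    exact hval _ (K1_ne_zero L hL2)
  · rw [hcs, hfnn]
    unfold csN fnnN etaN
    have e : 0.115 * (4 * (Real.pi ^ 2 * (lam2 / t)) * (1 + a * t / (4 * Real.pi ^ 2)))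
        = Real.pi ^ 2 * (lam2 / t) * 0.46 + a * (0.115 * (lam2 / t) * t) := by
      field_simp
      ring
    rw [e]
    have h1 : 0.115 * (lam2 / t) * t ≤ 1 := by nlinarith
    have h2 : 0 ≤ Real.pi ^ 2 * (lam2 / t) := by positivity
    nlinarith

end RowC

end Summit.HubbardSuperconductivity.HubbardSuperconductivity.Theorems.AnisotropyChord.Transfer.Fibre3
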